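import Literature.Geometry.Riemannian.PConvexDomainHomotopyType
import Literature.Geometry.Riemannian.BoundaryAdaptedMorseFunction
import Literature.Topology.FourManifolds.HandlebodyCWStructure

/-!
# Sha 1986, Thm. 1 (homotopy type of compact `p`-convex domains) — proof file

Sibling proof file (D-0014) of `PConvexDomainHomotopyType.lean`, which vendors J.-P. Sha,
*`p`-convex Riemannian manifolds*, Invent. Math. 83 (1986), Thm. 1 (flat compact case; H. Wu,
Indiana Univ. Math. J. 36 (1987); Harvey–Lawson 2013, §2; Xiong 2018, Thm. 4 (i)) as the named
fact `Literature.Geometry.Riemannian.Sha1986_homotopyEquiv_cwComplex_of_pConvex`: a compact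
domain `Ω = {F ≤ 0} ⊆ ℝⁿ⁺¹` with regular, `p`-convex boundary has the homotopy type of a finite
CW complex with no cells of dimension `≥ p`.  The fact is DISCHARGED here:

* `Literature.Geometry.Riemannian.Sha1986_homotopyEquiv_cwComplex_of_pConvex_holds`.

The proof has two halves, both in the tree:

1. (geometric) `exists_isRegularLevel_isHandlebodyOfIndexLE` (`BoundaryAdaptedMorseFunction.lean`,
   with `BoundaryAdaptedHessian.lean`, `BoundaryAdaptedProfile.lean`,
   `BoundaryAdaptedGenericity.lean`): a boundary-adapted Morse function `G = 1 + λ(-F)·k` on `Ω`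
   whose critical points are interior and of index `≤ p - 1` (the index bound is Sha's:
   `p`-convexity of the boundary forces `< p` negative directions of the Hessian), so that `Ω`
   is a compact handlebody of index `≤ p - 1` (`IsHandlebodyOfIndexLE n (p - 1)`);
2. (topological) `IsHandlebodyOfIndexLE.exists_finite_cwComplex_homotopyEquiv`
   (`Literature/Topology/FourManifolds/HandlebodyCWStructure.lean`; Milnor, *Morse theory*
   (1963), Thm. 3.5, through Milnor 1965 Thm. 3.14, the homotopy invariance of disc attachment
   and the CW structure on iterated disc attachments,
   `Literature/AlgebraicTopology/Homotopy/DiscAttachment*.lean`): such a handlebody is homotopy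
   equivalent to a finite CW complex with no cells of dimension `> p - 1`.

The printed proof (Sha; Wu) runs through the `p`-convex exhaustion function built from the
distance to the boundary and Greene–Wu smoothing; the tree's road replaces that first half by the
boundary-adapted height-type function, the Morse-theoretic second half being the same
(Milnor 1963, Thm. 3.5).  The hypothesis `p ≤ n` of the fact is not needed.  No `sorry`.

## References

* J.-P. Sha, *p-convex Riemannian manifolds*, Invent. Math. 83 (1986), 437–447, Thm. 1. [Sha1986]
* C. Xiong, *Homotopy type of manifolds with partially horoconvex boundary*, Int. J. Math. 29
  (2018), 1850074 (arXiv:1809.06982), Thm. 4 (i). [Xiong2018]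
* J. Milnor, *Morse theory*, Ann. of Math. Studies 51 (1963), Thm. 3.5. [Milnor1963]
-/

noncomputable section

namespace Literature.Geometry.Riemannian

open Literature.Topology.FourManifolds

/-- **Sha's theorem (homotopy type of a compact `p`-convex domain), discharged**: the named fact
`Sha1986_homotopyEquiv_cwComplex_of_pConvex` holds.  Proof: the geometric half
`exists_isRegularLevel_isHandlebodyOfIndexLE` (`BoundaryAdaptedMorseFunction.lean`: a boundary-adapted
Morse function on `Ω = {F ≤ 0}` with all critical points of index `≤ p - 1`, i.e. `Ω` is a
handlebody of index `≤ p - 1`) and the topological half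
`IsHandlebodyOfIndexLE.exists_finite_cwComplex_homotopyEquiv` (`HandlebodyCWStructure.lean`,
Milnor 1963, Thm. 3.5: such a handlebody has the homotopy type of a finite CW complex with no
cells of dimension `> p - 1`). [cite: Sha1986, Thm. 1] [cite: Xiong2018, Thm. 4 (i)]
[cite: Milnor1963, Thm. 3.5] -/
theorem Sha1986_homotopyEquiv_cwComplex_of_pConvex_holds :
    Sha1986_homotopyEquiv_cwComplex_of_pConvex := by
  intro n p F hp _ hF hK hreg hconv
  obtain ⟨G, hG, -, hcomp, hHB, ⟨eW⟩⟩ :=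
    exists_isRegularLevel_isHandlebodyOfIndexLE hp hF hK hreg hconv
  haveI := hcomp
  obtain ⟨C, _, _, _, hfin, hcell, ⟨e⟩⟩ := hHB.exists_finite_cwComplex_homotopyEquiv
  exact ⟨C, inferInstance, inferInstance, Set.univ, inferInstance, hfin,
    fun m hm => hcell m (by omega),
    ⟨(eW.symm.toHomotopyEquiv.trans e).trans (Homeomorph.Set.univ C).symm.toHomotopyEquiv⟩⟩

end Literature.Geometry.Riemannian
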